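import Mathlib.Analysis.SpecialFunctions.Log.Basic
import HarnessLib

/-!
# Corner rule of the H-axis annex: the strong-coupling gap ratio is monotone on its domain

Venture CertifiedManyBodySolver, cell `pub/hubbard-eph`, seat hubbard-eph-mod-2; namespace
`Summit.Ventures.CertifiedManyBodySolver.Eph`. The cell's H-axis annex (lead ruling R-19; tool
`hc2box_mod2.py`, design HC2-BOX-DESIGN v1) evaluates its field box at the CORNERS of the input box
`[T₋, T₊] × [ω₋, ω₊] × [λ₋, λ₊] × …`. Every ingredient is a monotone rational/power expression except
one: the strong-coupling gap ratio
`2Δ₀ / k_B T_c = 3.53 (1 + 12.5 t² ln(1/(2t)))`, `t = T_c/ω_log`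
(Carbotte 1990, eq. (4.1) — used there as an empirical fit; here only its SHAPE matters). This file
PROVES that `t ↦ t² ln(1/(2t))` — hence the gap ratio, hence `Δ₀ = ½ · ratio · k_B T_c` at fixed
`T_c` — is monotone INCREASING on `0 < t`, `2t ≤ e^{-1/2}` (i.e. `t ≤ 0.3033`; every conventional
superconductor has `t ≲ 0.25`), so the annex's `Δ₀` box is attained at the corners
`(T₋, ω₊)` and `(T₊, ω₋)`. Derivative-free proof from `ln x ≤ x − 1`.

WHAT THIS IS NOT: a statement about the accuracy of the fit (empirical, SCREENING-GRADE input of an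
EXTRAPOLATED annex); nothing about materials.
-/

noncomputable section

namespace Summit.Ventures.CertifiedManyBodySolver.Eph

open Real

/-- Core inequality: `u ↦ u² (−ln u)` is monotone increasing on `0 < u`, `ln u ≤ −1/2`
(i.e. `u ≤ e^{-1/2}`). Derivative-free: with `x = v/u ≥ 1`, `ln x ≤ x − 1` and `(v − u)² ≥ 0`. -/
theorem sq_mul_neg_log_mono {u v : ℝ} (hu : 0 < u) (huv : u ≤ v) (hv : Real.log v ≤ -1 / 2) :
    u ^ 2 * (-Real.log u) ≤ v ^ 2 * (-Real.log v) := by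
  have hv0 : 0 < v := lt_of_lt_of_le hu huv
  have hlog : Real.log v - Real.log u ≤ v / u - 1 := by
    rw [← Real.log_div hv0.ne' hu.ne']
    exact Real.log_le_sub_one_of_pos (div_pos hv0 hu)
  -- u² (−ln u) = u² (−ln v) + u² (ln v − ln u) ≤ u² (−ln v) + u² (v/u − 1) = u²(−ln v) + u v − u²
  have h1 : u ^ 2 * (Real.log v - Real.log u) ≤ u * v - u ^ 2 := by
    have := mul_le_mul_of_nonneg_left hlog (sq_nonneg u)
    have hsimp : u ^ 2 * (v / u - 1) = u * v - u ^ 2 := by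
      field_simp
    linarith [hsimp]
  -- and (v² − u²)(−ln v) ≥ (v² − u²)/2 ≥ u v − u² + … : collect
  have h2 : (v ^ 2 - u ^ 2) * (1 / 2) ≤ (v ^ 2 - u ^ 2) * (-Real.log v) := by
    apply mul_le_mul_of_nonneg_left _ (by nlinarith)
    linarith
  nlinarith [sq_nonneg (v - u), h1, h2]

/-- The Carbotte shape function `φ(t) = t² ln(1/(2t))`. -/
def gapShape (t : ℝ) : ℝ := t ^ 2 * Real.log (1 / (2 * t))

/-- The strong-coupling gap ratio `2Δ₀/(k_B T_c) = 3.53 (1 + 12.5 φ(t))`, `t = T_c/ω_log`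
(empirical fit; only its monotonicity is asserted here). -/
def gapRatio (t : ℝ) : ℝ := 3.53 * (1 + 12.5 * gapShape t)

/-- `φ(t) = ¼ · (2t)² · (−ln(2t))`. -/
theorem gapShape_eq (t : ℝ) : gapShape t = (1 / 4) * ((2 * t) ^ 2 * (-Real.log (2 * t))) := by
  unfold gapShape
  rw [one_div, Real.log_inv]
  ring

/-- **`φ` is monotone increasing on `0 < t₁ ≤ t₂` with `ln(2 t₂) ≤ −1/2`** (`t₂ ≤ e^{−1/2}/2 ≈ 0.303`). -/
theorem gapShape_mono {t₁ t₂ : ℝ} (h₁ : 0 < t₁) (h : t₁ ≤ t₂) (h₂ : Real.log (2 * t₂) ≤ -1 / 2) :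
    gapShape t₁ ≤ gapShape t₂ := by
  rw [gapShape_eq t₁, gapShape_eq t₂]
  have key := sq_mul_neg_log_mono (u := 2 * t₁) (v := 2 * t₂) (by linarith) (by linarith) h₂
  linarith

/-- **The gap ratio is monotone increasing in `t = T_c/ω_log`** on the same domain. -/
theorem gapRatio_mono {t₁ t₂ : ℝ} (h₁ : 0 < t₁) (h : t₁ ≤ t₂) (h₂ : Real.log (2 * t₂) ≤ -1 / 2) :
    gapRatio t₁ ≤ gapRatio t₂ := by
  unfold gapRatio
  have := gapShape_mono h₁ h h₂
  nlinarith

/-- `φ ≥ 0` on the domain (`ln(2t) ≤ 0`), hence the ratio is `≥ 3.53 > 0` there. -/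
theorem gapRatio_pos {t : ℝ} (h : Real.log (2 * t) ≤ -1 / 2) : 0 < gapRatio t := by
  unfold gapRatio
  have hφ : 0 ≤ gapShape t := by
    rw [gapShape_eq t]
    have : 0 ≤ -Real.log (2 * t) := by linarith
    positivity
  nlinarith

/-- **Corner rule for `Δ₀` at fixed `ω_log`**: `T ↦ ½ · ratio(T/ω) · T` is monotone increasing in
`T` on `0 < T₁ ≤ T₂`, `ln(2 T₂/ω) ≤ −1/2` (`ω > 0`); units: `Δ₀/k_B` in the unit of `T`. -/
theorem gap_mono_T {ω T₁ T₂ : ℝ} (hω : 0 < ω) (h₁ : 0 < T₁) (h : T₁ ≤ T₂)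
    (h₂ : Real.log (2 * (T₂ / ω)) ≤ -1 / 2) :
    (1 / 2) * gapRatio (T₁ / ω) * T₁ ≤ (1 / 2) * gapRatio (T₂ / ω) * T₂ := by
  have ht₁ : 0 < T₁ / ω := div_pos h₁ hω
  have hle : T₁ / ω ≤ T₂ / ω := div_le_div_of_nonneg_right h hω.le
  have hR := gapRatio_mono ht₁ hle h₂
  have hRpos := gapRatio_pos (t := T₁ / ω) (by
    have : Real.log (2 * (T₁ / ω)) ≤ Real.log (2 * (T₂ / ω)) :=
      Real.log_le_log (by positivity) (by linarith)
    linarith)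
  have hR2pos : 0 < gapRatio (T₂ / ω) := lt_of_lt_of_le hRpos hR
  nlinarith [mul_le_mul_of_nonneg_right hR h₁.le, mul_le_mul_of_nonneg_left h hR2pos.le]

/-- **Corner rule for `Δ₀` at fixed `T_c`**: `ω ↦ ratio(T/ω)` is monotone DEcreasing in `ω_log` on
`0 < ω₁ ≤ ω₂` with `ln(2T/ω₁) ≤ −1/2` (`T > 0`) — a larger phonon scale means weaker coupling
corrections. -/
theorem gapRatio_anti_omega {T ω₁ ω₂ : ℝ} (hT : 0 < T) (h₁ : 0 < ω₁) (h : ω₁ ≤ ω₂)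
    (hdom : Real.log (2 * (T / ω₁)) ≤ -1 / 2) :
    gapRatio (T / ω₂) ≤ gapRatio (T / ω₁) := by
  have h₂ : 0 < ω₂ := lt_of_lt_of_le h₁ h
  have hle : T / ω₂ ≤ T / ω₁ := div_le_div_of_nonneg_left hT.le h₁ h
  exact gapRatio_mono (div_pos hT h₂) hle hdom

end Summit.Ventures.CertifiedManyBodySolver.Eph

end
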